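import Summits.KontsevichZagierPeriods.KontsevichZagierPeriods.Theorems.ToricCoreToricCells

/-!
# `TornheimToric` (stmt-KontsevichZagierPeriods-7838, route ToricCore) — proof

Tornheim's `W(1,1,1) = Σ 1/(mn(m+n)) = 2 ζ(2,1)` as a TORIC chain (card T1 of route ToricCore):
for the cube representations `S = [□³, x₂/((1−x₀x₂)(1−x₁x₂))]` and
`Z₂₁ = [□³, x₀x₁/((1−x₀x₁)(1−x₀x₁x₂))]`, `[S] − 2·[Z₂₁] ∈ R_tor` (token for token
`KZ.toricRelations`). The chain, entirely inside the toric sub-calculus: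

1. **binomial cut** (move (1a) in `T`): `□³ = C₁ ⊔ C₂`, `C₁ = □³ ∩ {x₀ < x₁}`,
   `C₂ = □³ ∩ {x₁ ≤ x₀}` (disjoint): `[S] − [S|C₁] − [S|C₂] ∈ R_tor`;
2. **peeling the diagonal** (move (1a) in `T` twice): `C₂ = C₂' ⊔ D`, `C₂' = □³ ∩ {x₁ < x₀}`,
   `D = □³ ∩ {x₀ = x₁}`: `[S|C₂] − [S|C₂'] − [S|D] ∈ R_tor`, and `[S|D] ∈ R_tor` since `D` is a
   null toric cell (`σ = σ ∪ σ` instance of (1a));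
3. **two integer monomial maps** from `Z₂₁`: `Ψ₁(y) = (y₀y₂, y₀, y₁)` (matrix rows `(1,0,1)`,
   `(1,0,0)`, `(0,1,0)`, `det = 1`) carries `□³` onto `C₁`, and `Ψ₂(y) = (y₀, y₀y₂, y₁)` (rows
   `(1,0,0)`, `(1,0,1)`, `(0,1,0)`, `det = −1`) carries `□³` onto `C₂'`; both have toric Jacobian
   factor `y₀` and `S(Ψᵢ y) · y₀ = Z₂₁(y)` identically (the planner's monomial maps composed with
   its coordinate permutation), so `[Z₂₁] − [S|C₁]`, `[Z₂₁] − [S|C₂'] ∈ R_tor`.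

Summing, `[S] − 2[Z₂₁] = (1) + (2) + [S|D] − ([Z₂₁] − [S|C₁]) − ([Z₂₁] − [S|C₂'])`. All cells are
cube cells of `ToricCoreToricCells` (toric as data, semialgebraic), the pieces are restrictions of
`S`. (lead c10 of crux 9129, banking)
-/

open Set MeasureTheory MvPolynomial
open Literature.NumberTheory.Transcendental
open Literature.ModelTheory.ExponentialFields (IsSemialgebraic)

namespace Summit.KontsevichZagierPeriods.ToricCore

/-! ### The two integrands are toric -/

/-- **`S` restricted to any cube cell is toric**: a representation on `□³ ∩ cell(g, h)` whose
integrand agrees there with `x₂/((1−x₀x₂)(1−x₁x₂)) = X₂ / ((1 − x₀x₂)(1 − x₁x₂))` is toric.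
[cite: GuoPaychaZhang2014, §2] -/
theorem isToric_S {N M : ℕ} (q : KZ.IntegralRep 3) (g : Fin N → (Fin 3 → ℝ) → ℝ)
    (h : Fin M → (Fin 3 → ℝ) → ℝ) (hg : ∀ k, KZ.IsSignedBinomial (g k))
    (hh : ∀ k, KZ.IsSignedBinomial (h k))
    (hdom : q.domain = {x | (∀ i, 0 < x i ∧ x i < 1) ∧ (∀ k, 0 < g k x) ∧ ∀ k, 0 ≤ h k x})
    (hint : EqOn q.integrand (fun x => x 2 / ((1 - x 0 * x 2) * (1 - x 1 * x 2))) q.domain) :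
    KZ.IsToric q := by
  refine isToric_of_cell q g h ![fun x => 1 - x 0 * x 2, fun x => 1 - x 1 * x 2] (X 2) hg hh
    (fun k => by
      fin_cases k
      · exact isSignedBinomial_one_sub_x0x2
      · exact isSignedBinomial_one_sub_x1x2) hdom
    fun x hx => ?_
  rw [hint hx]
  simp [Fin.prod_univ_two]

/-- **`Z₂₁` on the cube is toric**: a representation on `□³` whose integrand agrees there with
`x₀x₁/((1−x₀x₁)(1−x₀x₁x₂))` is toric. [cite: GuoPaychaZhang2014, §2] -/
theorem isToric_Z (q : KZ.IntegralRep 3) (hdom : q.domain = {x | ∀ i, 0 < x i ∧ x i < 1})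
    (hint : EqOn q.integrand (fun x => x 0 * x 1 / ((1 - x 0 * x 1) * (1 - x 0 * x 1 * x 2)))
      q.domain) :
    KZ.IsToric q := by
  refine isToric_of_cell q ![] ![] ![fun x => 1 - x 0 * x 1, fun x => 1 - x 0 * x 1 * x 2]
    (X 0 * X 1) (fun k => k.elim0) (fun k => k.elim0)
    (fun k => by
      fin_cases k
      · exact isSignedBinomial_one_sub_x0x1
      · exact isSignedBinomial_one_sub_x0x1x2) (by rw [hdom]; ext x; simp)
    fun x hx => ?_
  rw [hint hx]
  simp [Fin.prod_univ_two]

/-! ### The two monomial maps -/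

/-- The monomial map of the matrix with rows `(1,0,1)`, `(1,0,0)`, `(0,1,0)` is
`Ψ₁(y) = (y₀y₂, y₀, y₁)`. [folklore] -/
theorem monomialMap_one (y : Fin 3 → ℝ) :
    (fun i => ∏ j, y j ^ (!![1, 0, 1; 1, 0, 0; 0, 1, 0] : Matrix (Fin 3) (Fin 3) ℤ) i j) =
      ![y 0 * y 2, y 0, y 1] := by
  funext i
  fin_cases i <;> simp [Fin.prod_univ_three]

/-- The monomial map of the matrix with rows `(1,0,0)`, `(1,0,1)`, `(0,1,0)` is
`Ψ₂(y) = (y₀, y₀y₂, y₁)`. [folklore] -/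
theorem monomialMap_two (y : Fin 3 → ℝ) :
    (fun i => ∏ j, y j ^ (!![1, 0, 0; 1, 0, 1; 0, 1, 0] : Matrix (Fin 3) (Fin 3) ℤ) i j) =
      ![y 0, y 0 * y 2, y 1] := by
  funext i
  fin_cases i <;> simp [Fin.prod_univ_three]

/-- **`Ψ₁` carries the open cube onto `C₁ = □³ ∩ {x₀ < x₁}`** (inverse `y = (x₁, x₂, x₀/x₁)`).
[folklore] -/
theorem image_monomialMap_one :
    (fun (y : Fin 3 → ℝ) i => ∏ j, y j ^ (!![1, 0, 1; 1, 0, 0; 0, 1, 0] : Matrix (Fin 3) (Fin 3) ℤ) i j) ''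
        {y | ∀ i, 0 < y i ∧ y i < 1} =
      {x : Fin 3 → ℝ | (∀ i, 0 < x i ∧ x i < 1) ∧
        (∀ k, 0 < (![fun x : Fin 3 → ℝ => x 1 - x 0] : Fin 1 → (Fin 3 → ℝ) → ℝ) k x) ∧
        ∀ k, 0 ≤ (![] : Fin 0 → (Fin 3 → ℝ) → ℝ) k x} := by
  ext x
  simp only [mem_image, mem_setOf_eq, monomialMap_one, Fin.forall_fin_one, IsEmpty.forall_iff,
    and_true, Matrix.cons_val_zero, sub_pos]
  constructor
  · rintro ⟨y, hy, rfl⟩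
    have h0 := hy 0; have h1 := hy 1; have h2 := hy 2
    refine ⟨fun i => ?_, ?_⟩
    · fin_cases i
      · simp only [Fin.zero_eta, Matrix.cons_val_zero]
        exact ⟨mul_pos h0.1 h2.1, by nlinarith⟩
      · simpa using h0
      · simpa using h1
    · simp only [Matrix.cons_val_one, Matrix.cons_val_zero]
      nlinarith
  · rintro ⟨hx, h01⟩
    have h0 := hx 0; have h1 := hx 1; have h2 := hx 2
    refine ⟨![x 1, x 2, x 0 / x 1], fun i => ?_, ?_⟩
    · fin_cases i
      · simpa using h1
      · simpa using h2
      · simp only [Fin.reduceFinMk, Matrix.cons_val_two, Matrix.tail_cons, Matrix.head_cons]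
        exact ⟨div_pos h0.1 h1.1, (div_lt_one h1.1).mpr h01⟩
    · funext i
      fin_cases i
      · simp only [Fin.zero_eta, Matrix.cons_val_zero, Matrix.cons_val_two, Matrix.tail_cons,
          Matrix.head_cons]
        rw [mul_div_assoc']
        exact mul_div_cancel_left₀ _ h1.1.ne'
      · simp
      · simp

/-- **`Ψ₂` carries the open cube onto `C₂' = □³ ∩ {x₁ < x₀}`** (inverse `y = (x₀, x₂, x₁/x₀)`).
[folklore] -/
theorem image_monomialMap_two :
    (fun (y : Fin 3 → ℝ) i => ∏ j, y j ^ (!![1, 0, 0; 1, 0, 1; 0, 1, 0] : Matrix (Fin 3) (Fin 3) ℤ) i j) ''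
        {y | ∀ i, 0 < y i ∧ y i < 1} =
      {x : Fin 3 → ℝ | (∀ i, 0 < x i ∧ x i < 1) ∧
        (∀ k, 0 < (![fun x : Fin 3 → ℝ => x 0 - x 1] : Fin 1 → (Fin 3 → ℝ) → ℝ) k x) ∧
        ∀ k, 0 ≤ (![] : Fin 0 → (Fin 3 → ℝ) → ℝ) k x} := by
  ext x
  simp only [mem_image, mem_setOf_eq, monomialMap_two, Fin.forall_fin_one, IsEmpty.forall_iff,
    and_true, Matrix.cons_val_zero, sub_pos]
  constructor
  · rintro ⟨y, hy, rfl⟩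
    have h0 := hy 0; have h1 := hy 1; have h2 := hy 2
    refine ⟨fun i => ?_, ?_⟩
    · fin_cases i
      · simpa using h0
      · simp only [Fin.mk_one, Matrix.cons_val_one, Matrix.cons_val_zero]
        exact ⟨mul_pos h0.1 h2.1, by nlinarith⟩
      · simpa using h1
    · simp only [Matrix.cons_val_one, Matrix.cons_val_zero]
      nlinarith
  · rintro ⟨hx, h10⟩
    have h0 := hx 0; have h1 := hx 1; have h2 := hx 2
    refine ⟨![x 0, x 2, x 1 / x 0], fun i => ?_, ?_⟩
    · fin_cases i
      · simpa using h0
      · simpa using h2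
      · simp only [Fin.reduceFinMk, Matrix.cons_val_two, Matrix.tail_cons, Matrix.head_cons]
        exact ⟨div_pos h1.1 h0.1, (div_lt_one h0.1).mpr h10⟩
    · funext i
      fin_cases i
      · simp
      · simp only [Fin.mk_one, Matrix.cons_val_one, Matrix.cons_val_zero,
          Matrix.cons_val_two, Matrix.tail_cons, Matrix.head_cons]
        rw [mul_div_assoc']
        exact mul_div_cancel_left₀ _ h0.1.ne'
      · simp

/-- Denominators of `Z₂₁` do not vanish on the cube. [folklore] -/
theorem denominators_ne_zero (y : Fin 3 → ℝ) (hy : ∀ i, 0 < y i ∧ y i < 1) :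
    1 - y 0 * y 1 ≠ 0 ∧ 1 - y 0 * y 1 * y 2 ≠ 0 := by
  have h01 : y 0 * y 1 < 1 := mul_lt_one_of_nonneg_of_lt_one_left (hy 0).1.le (hy 0).2 (hy 1).2.le
  have h012 : y 0 * y 1 * y 2 < 1 :=
    mul_lt_one_of_nonneg_of_lt_one_left (mul_nonneg (hy 0).1.le (hy 1).1.le) h01 (hy 2).2.le
  exact ⟨by linarith, by linarith⟩

/-- **The integrands transform exactly along `Ψ₁`**: `Z₂₁(y) = S(Ψ₁ y) · |det| (∏ᵢ Ψ₁(y)ᵢ)/∏ⱼ yⱼ`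
on the cube (`det = 1`, toric Jacobian factor `y₀`). [cite: Tornheim1950] -/
theorem integrand_monomialMap_one (y : Fin 3 → ℝ) (hy : ∀ i, 0 < y i ∧ y i < 1) :
    y 0 * y 1 / ((1 - y 0 * y 1) * (1 - y 0 * y 1 * y 2)) =
      (fun x : Fin 3 → ℝ => x 2 / ((1 - x 0 * x 2) * (1 - x 1 * x 2)))
          (fun i => ∏ j, y j ^ (!![1, 0, 1; 1, 0, 0; 0, 1, 0] : Matrix (Fin 3) (Fin 3) ℤ) i j) *
        (|(((!![1, 0, 1; 1, 0, 0; 0, 1, 0] : Matrix (Fin 3) (Fin 3) ℤ).det : ℤ) : ℝ)| *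
          (∏ i, ∏ j, y j ^ (!![1, 0, 1; 1, 0, 0; 0, 1, 0] : Matrix (Fin 3) (Fin 3) ℤ) i j) /
            ∏ j, y j) := by
  have h0 := (hy 0).1.ne'
  have h1 := (hy 1).1.ne'
  have h2 := (hy 2).1.ne'
  obtain ⟨h01, h012⟩ := denominators_ne_zero y hy
  have hdet : (!![1, 0, 1; 1, 0, 0; 0, 1, 0] : Matrix (Fin 3) (Fin 3) ℤ).det = 1 := by
    simp [Matrix.det_fin_three]
  rw [hdet, show (∏ i, ∏ j, y j ^ (!![1, 0, 1; 1, 0, 0; 0, 1, 0] : Matrix (Fin 3) (Fin 3) ℤ) i j) =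
    ∏ i, (![y 0 * y 2, y 0, y 1] : Fin 3 → ℝ) i from congrArg (fun v : Fin 3 → ℝ => ∏ i, v i)
      (monomialMap_one y), monomialMap_one]
  simp only [Matrix.cons_val_zero, Matrix.cons_val_one, Matrix.head_cons, Matrix.cons_val_two,
    Matrix.tail_cons, Fin.prod_univ_three, Int.cast_one, abs_one, one_mul]
  field_simp

/-- **The integrands transform exactly along `Ψ₂`** (`det = −1`, toric Jacobian factor `y₀`).
[cite: Tornheim1950] -/
theorem integrand_monomialMap_two (y : Fin 3 → ℝ) (hy : ∀ i, 0 < y i ∧ y i < 1) :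
    y 0 * y 1 / ((1 - y 0 * y 1) * (1 - y 0 * y 1 * y 2)) =
      (fun x : Fin 3 → ℝ => x 2 / ((1 - x 0 * x 2) * (1 - x 1 * x 2)))
          (fun i => ∏ j, y j ^ (!![1, 0, 0; 1, 0, 1; 0, 1, 0] : Matrix (Fin 3) (Fin 3) ℤ) i j) *
        (|(((!![1, 0, 0; 1, 0, 1; 0, 1, 0] : Matrix (Fin 3) (Fin 3) ℤ).det : ℤ) : ℝ)| *
          (∏ i, ∏ j, y j ^ (!![1, 0, 0; 1, 0, 1; 0, 1, 0] : Matrix (Fin 3) (Fin 3) ℤ) i j) /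
            ∏ j, y j) := by
  have h0 := (hy 0).1.ne'
  have h1 := (hy 1).1.ne'
  have h2 := (hy 2).1.ne'
  obtain ⟨h01, h012⟩ := denominators_ne_zero y hy
  have hdet : (!![1, 0, 0; 1, 0, 1; 0, 1, 0] : Matrix (Fin 3) (Fin 3) ℤ).det = -1 := by
    simp [Matrix.det_fin_three]
  rw [hdet, show (∏ i, ∏ j, y j ^ (!![1, 0, 0; 1, 0, 1; 0, 1, 0] : Matrix (Fin 3) (Fin 3) ℤ) i j) =
    ∏ i, (![y 0, y 0 * y 2, y 1] : Fin 3 → ℝ) i from congrArg (fun v : Fin 3 → ℝ => ∏ i, v i)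
      (monomialMap_two y), monomialMap_two]
  simp only [Matrix.cons_val_zero, Matrix.cons_val_one, Matrix.head_cons, Matrix.cons_val_two,
    Matrix.tail_cons, Fin.prod_univ_three, Int.cast_neg, Int.cast_one, abs_neg, abs_one, one_mul]
  field_simp

/-! ### The item -/

/-- **`TornheimToric` over the Literature constants**: for `S` and `Z₂₁` as in the item,
`[S] − 2·[Z₂₁] ∈ KZ.toricRelations`, by the chain: binomial cut `□³ = C₁ ⊔ C₂`, peeling of the
null diagonal `C₂ = C₂' ⊔ D` (both (1a) inside `T`), `[S|D] ∈ R_tor` (null toric cell), and the two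
monomial moves `[Z₂₁] − [S|C₁]`, `[Z₂₁] − [S|C₂']` along `Ψ₁`, `Ψ₂`. [cite: Tornheim1950]
[cite: KontsevichZagier2001, §1.2] -/
theorem tornheim_sub_two_nsmul_mem_toricRelations (r r' : KZ.IntegralRep 3)
    (hr : r.domain = {x | ∀ i, 0 < x i ∧ x i < 1})
    (hri : EqOn r.integrand (fun x => x 2 / ((1 - x 0 * x 2) * (1 - x 1 * x 2))) r.domain)
    (hr' : r'.domain = {x | ∀ i, 0 < x i ∧ x i < 1})
    (hri' : EqOn r'.integrand (fun x => x 0 * x 1 / ((1 - x 0 * x 1) * (1 - x 0 * x 1 * x 2)))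
      r'.domain) :
    KZ.of r - 2 • KZ.of r' ∈ KZ.toricRelations := by
  -- signed-binomial families of the four cells
  have hg₁ : ∀ k, KZ.IsSignedBinomial ((![fun x : Fin 3 → ℝ => x 1 - x 0] : Fin 1 → _) k) := by
    intro k; fin_cases k; exact isSignedBinomial_x1_sub_x0
  have hg₂ : ∀ k, KZ.IsSignedBinomial ((![fun x : Fin 3 → ℝ => x 0 - x 1] : Fin 1 → _) k) := by
    intro k; fin_cases k; exact isSignedBinomial_x0_sub_x1
  have hgd : ∀ k, KZ.IsSignedBinomial
      ((![fun x : Fin 3 → ℝ => x 0 - x 1, fun x => x 1 - x 0] : Fin 2 → _) k) := by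
    intro k; fin_cases k
    · exact isSignedBinomial_x0_sub_x1
    · exact isSignedBinomial_x1_sub_x0
  have h0 : ∀ k, KZ.IsSignedBinomial ((![] : Fin 0 → (Fin 3 → ℝ) → ℝ) k) := fun k => k.elim0
  -- the four cells (cube cells, hence semialgebraic) and the restrictions of `S` to them
  set C₁ := {x : Fin 3 → ℝ | (∀ i, 0 < x i ∧ x i < 1) ∧
    (∀ k, 0 < (![fun x : Fin 3 → ℝ => x 1 - x 0] : Fin 1 → (Fin 3 → ℝ) → ℝ) k x) ∧
    ∀ k, 0 ≤ (![] : Fin 0 → (Fin 3 → ℝ) → ℝ) k x} with hC₁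
  set C₂ := {x : Fin 3 → ℝ | (∀ i, 0 < x i ∧ x i < 1) ∧
    (∀ k, 0 < (![] : Fin 0 → (Fin 3 → ℝ) → ℝ) k x) ∧
    ∀ k, 0 ≤ (![fun x : Fin 3 → ℝ => x 0 - x 1] : Fin 1 → (Fin 3 → ℝ) → ℝ) k x} with hC₂
  set C₂' := {x : Fin 3 → ℝ | (∀ i, 0 < x i ∧ x i < 1) ∧
    (∀ k, 0 < (![fun x : Fin 3 → ℝ => x 0 - x 1] : Fin 1 → (Fin 3 → ℝ) → ℝ) k x) ∧
    ∀ k, 0 ≤ (![] : Fin 0 → (Fin 3 → ℝ) → ℝ) k x} with hC₂'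
  set D := {x : Fin 3 → ℝ | (∀ i, 0 < x i ∧ x i < 1) ∧
    (∀ k, 0 < (![] : Fin 0 → (Fin 3 → ℝ) → ℝ) k x) ∧
    ∀ k, 0 ≤ (![fun x : Fin 3 → ℝ => x 0 - x 1, fun x => x 1 - x 0] : Fin 2 → (Fin 3 → ℝ) → ℝ) k x}
    with hD
  -- plain membership
  have mC₁ : ∀ x, x ∈ C₁ ↔ (∀ i, 0 < x i ∧ x i < 1) ∧ x 0 < x 1 := fun x => by
    simp [hC₁]
  have mC₂ : ∀ x, x ∈ C₂ ↔ (∀ i, 0 < x i ∧ x i < 1) ∧ x 1 ≤ x 0 := fun x => by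
    simp [hC₂]
  have mC₂' : ∀ x, x ∈ C₂' ↔ (∀ i, 0 < x i ∧ x i < 1) ∧ x 1 < x 0 := fun x => by
    simp [hC₂']
  have mD : ∀ x, x ∈ D ↔ (∀ i, 0 < x i ∧ x i < 1) ∧ x 1 ≤ x 0 ∧ x 0 ≤ x 1 := fun x => by
    simp [hD, Fin.forall_fin_two]
  have sC₁ : C₁ ⊆ r.domain := fun x hx => by rw [hr]; exact ((mC₁ x).1 hx).1
  have sC₂ : C₂ ⊆ r.domain := fun x hx => by rw [hr]; exact ((mC₂ x).1 hx).1
  have sC₂' : C₂' ⊆ r.domain := fun x hx => by rw [hr]; exact ((mC₂' x).1 hx).1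
  have sD : D ⊆ r.domain := fun x hx => by rw [hr]; exact ((mD x).1 hx).1
  set r₁ := r.restrict C₁ (isSemialgebraic_cube_inter _ _ hg₁ h0) sC₁ with hr₁
  set r₂ := r.restrict C₂ (isSemialgebraic_cube_inter _ _ h0 hg₂) sC₂ with hr₂
  set r₂' := r.restrict C₂' (isSemialgebraic_cube_inter _ _ hg₂ h0) sC₂' with hr₂'
  set rD := r.restrict D (isSemialgebraic_cube_inter _ _ h0 hgd) sD with hrD
  -- everything is toric as data
  have hT : KZ.of r ∈ KZ.toricSpan :=
    KZ.of_mem_toricSpan (isToric_S r ![] ![] h0 h0 (by rw [hr]; ext x; simp) hri)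
  have hT₁ : KZ.of r₁ ∈ KZ.toricSpan :=
    KZ.of_mem_toricSpan (isToric_S r₁ _ _ hg₁ h0 rfl (hri.mono sC₁))
  have hT₂ : KZ.of r₂ ∈ KZ.toricSpan :=
    KZ.of_mem_toricSpan (isToric_S r₂ _ _ h0 hg₂ rfl (hri.mono sC₂))
  have hT₂' : KZ.of r₂' ∈ KZ.toricSpan :=
    KZ.of_mem_toricSpan (isToric_S r₂' _ _ hg₂ h0 rfl (hri.mono sC₂'))
  have hTD : KZ.of rD ∈ KZ.toricSpan :=
    KZ.of_mem_toricSpan (isToric_S rD _ _ h0 hgd rfl (hri.mono sD))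
  have hT' : KZ.of r' ∈ KZ.toricSpan := KZ.of_mem_toricSpan (isToric_Z r' hr' hri')
  -- (1) the binomial cut
  have R1 : KZ.of r - KZ.of r₁ - KZ.of r₂ ∈ KZ.toricRelations := by
    refine domainAdd_mem_toricRelations hT hT₁ hT₂ ?_ ?_ (fun _ _ => rfl) (fun _ _ => rfl)
    · show r.domain = C₁ ∪ C₂
      rw [hr]
      ext x
      simp only [mem_setOf_eq, mem_union, mC₁, mC₂]
      exact ⟨fun hx => (lt_or_ge (x 0) (x 1)).imp (fun h => ⟨hx, h⟩) fun h => ⟨hx, h⟩,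
        fun h => h.elim And.left And.left⟩
    · show volume (C₁ ∩ C₂) = 0
      have he : C₁ ∩ C₂ = ∅ := by
        ext x
        simp only [mem_inter_iff, mC₁, mC₂, mem_empty_iff_false, iff_false]
        rintro ⟨⟨-, h1⟩, -, h2⟩
        exact absurd h1 (not_lt.mpr h2)
      rw [he, measure_empty]
  -- (2) peeling the diagonal
  have R2 : KZ.of r₂ - KZ.of r₂' - KZ.of rD ∈ KZ.toricRelations := by
    refine domainAdd_mem_toricRelations hT₂ hT₂' hTD ?_ ?_ (fun _ _ => rfl) (fun _ _ => rfl)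
    · show C₂ = C₂' ∪ D
      ext x
      simp only [mem_union, mC₂, mC₂', mD]
      constructor
      · rintro ⟨hx, h⟩
        rcases h.lt_or_eq with h' | h'
        · exact Or.inl ⟨hx, h'⟩
        · exact Or.inr ⟨hx, h, h'.ge⟩
      · rintro (⟨hx, h⟩ | ⟨hx, h, -⟩)
        · exact ⟨hx, h.le⟩
        · exact ⟨hx, h⟩
    · show volume (C₂' ∩ D) = 0
      have he : C₂' ∩ D = ∅ := by
        ext x
        simp only [mem_inter_iff, mC₂', mD, mem_empty_iff_false, iff_false]
        rintro ⟨⟨-, h1⟩, -, -, h2⟩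
        exact absurd h1 (not_lt.mpr h2)
      rw [he, measure_empty]
  -- the diagonal cell is null
  have R3 : KZ.of rD ∈ KZ.toricRelations := by
    refine of_mem_toricRelations_of_volume_eq_zero hTD (measure_mono_null (fun x hx => ?_)
      (volume_setOf_apply_eq_apply (0 : Fin 3) 1 (by decide)))
    have h := (mD x).1 hx
    exact le_antisymm h.2.2 h.2.1
  -- (3) the two monomial moves
  have hpos : ∀ y ∈ r'.domain, ∀ i, 0 < y i := fun y hy i => by
    rw [hr'] at hy
    exact (hy i).1
  have R4 : KZ.of r' - KZ.of r₁ ∈ KZ.toricRelations := by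
    refine KZ.sub_mem_toricRelations_of_monomial hT' hT₁ !![1, 0, 1; 1, 0, 0; 0, 1, 0]
      (by simp [Matrix.det_fin_three]) hpos (by rw [hr']; exact image_monomialMap_one.symm)
      fun y hy => ?_
    rw [hr'] at hy
    have hy' : (fun i => ∏ j, y j ^ (!![1, 0, 1; 1, 0, 0; 0, 1, 0] : Matrix (Fin 3) (Fin 3) ℤ) i j) ∈
        r.domain := sC₁ (by rw [hC₁, ← image_monomialMap_one]; exact mem_image_of_mem _ hy)
    rw [hri' (hr' ▸ hy), show r₁.integrand = r.integrand from rfl, hri hy']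
    exact integrand_monomialMap_one y hy
  have R5 : KZ.of r' - KZ.of r₂' ∈ KZ.toricRelations := by
    refine KZ.sub_mem_toricRelations_of_monomial hT' hT₂' !![1, 0, 0; 1, 0, 1; 0, 1, 0]
      (by simp [Matrix.det_fin_three]) hpos (by rw [hr']; exact image_monomialMap_two.symm)
      fun y hy => ?_
    rw [hr'] at hy
    have hy' : (fun i => ∏ j, y j ^ (!![1, 0, 0; 1, 0, 1; 0, 1, 0] : Matrix (Fin 3) (Fin 3) ℤ) i j) ∈
        r.domain := sC₂' (by rw [hC₂', ← image_monomialMap_two]; exact mem_image_of_mem _ hy)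
    rw [hri' (hr' ▸ hy), show r₂'.integrand = r.integrand from rfl, hri hy']
    exact integrand_monomialMap_two y hy
  -- summing up
  have he : KZ.of r - 2 • KZ.of r' = (KZ.of r - KZ.of r₁ - KZ.of r₂) +
      (KZ.of r₂ - KZ.of r₂' - KZ.of rD) + KZ.of rD - (KZ.of r' - KZ.of r₁) -
      (KZ.of r' - KZ.of r₂') := by
    abel
  rw [he]
  exact sub_mem (sub_mem (add_mem (add_mem R1 R2) R3) R4) R5

/-- **`TornheimToric`** (route ToricCore, stmt-KontsevichZagierPeriods-7838, card T1): for cube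
representations `S = [□³, x₂/((1−x₀x₂)(1−x₁x₂))]` (Tornheim's `W(1,1,1) = Σ 1/(mn(m+n))`) and
`Z₂₁ = [□³, x₀x₁/((1−x₀x₁)(1−x₀x₁x₂))]` (`ζ(2,1)`), `[S] − 2·[Z₂₁] ∈ R_tor`: one binomial cut
`□³ = {x₀<x₁} ⊔ {x₁≤x₀}`, removal of the null diagonal inside `R_tor`, and the two unimodular
monomial maps `(y₀y₂, y₀, y₁)`, `(y₀, y₀y₂, y₁)` from the cube of `Z₂₁` onto the two open pieces
(Jacobian factor `y₀`, integrands transforming exactly). The route's inline `let T; let R` are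
token for token `KZ.toricSpan`, `KZ.toricRelations`, so this is
`tornheim_sub_two_nsmul_mem_toricRelations`. [cite: Tornheim1950]
[cite: KontsevichZagier2001, §1.2] -/
theorem tornheimToric_proof :
    Summit.KontsevichZagierPeriods.KontsevichZagierPeriods.Theses.ToricCore.TornheimToric :=
  tornheim_sub_two_nsmul_mem_toricRelations

end Summit.KontsevichZagierPeriods.ToricCore
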